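import Literature.MathematicalPhysics.QuantumLattice.HubbardTorusFluxThermalBlochBound
import Mathlib
import HarnessLib

/-!
# Flux-blindness of short walks — part 1 (model-free): trinomial pencils, root-of-unity averaging, unit-diagonal gauge
# invariance of sector moments, Taylor coefficients of `β ↦ tr e^{−βH}`

Matrix analysis used by `TcThermcert1FluxBlindness.lean` (line `zerofree_corridor` on TcThermcert1's crux K1 =
`ThermalStiffnessCeilingU8b10_le_1o8`, stmt-Ventures-26381; planner `hubbard-floor-idea-rescuer` g6; provenance: crux workfile
`Cruxes/ThermalStiffnessCeilingU8b10_le_1o8/Lines/zerofree_corridor.lean` §A, §D, tree 6d964f73f6ce):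
* (A1) `trace_pencil_pow_eq_sum`: on the unit circle `u = e^{iψ}` the trace of the `k`-th power of a trinomial pencil
  `M₀ + u M₊ + u⁻¹ M₋` is a trigonometric polynomial `Σ_{d ≤ 2k} g_d e^{i(d−k)ψ}` (polynomial lift `Q(X) = M₋ + X M₀ + X² M₊`,
  `Polynomial.eval_eq_sum_range'`, `AddMonoidHom.map_trace`);
* (A2) `trigPoly_eq_const_of_periodic`: a trigonometric polynomial of degree `k < L` which is `2π/L`-periodic is constant
  (root-of-unity averaging, `geom_sum_eq`, `Complex.exp_eq_one_iff`);
* `trace_pow_toBlock_diagonal_conj`: conjugating by a unit-modulus diagonal does not change traces of powers of sector blocks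
  (for whatever `DecidableEq` instance built the diagonal); `toBlock_pencil`;
* (D) `iteratedDeriv_trace_exp_neg_smul`: `(d/dβ)^k tr e^{−βH}|_{β=0} = (−1)^k tr H^k` in the `L²`-operator Banach algebra
  (`hasDerivAt_exp_smul_const'`).
HONEST FRAMING: pure finite-dimensional matrix analysis; nothing here concerns the Hubbard model at `U = 8`; superconductivity in
the Hubbard model is NOT proved (or disproved) by any of this.
-/

noncomputable section

namespace Summit.Ventures.CertifiedManyBodySolver.Theorems.TcThermcert1.FluxBlindness

open Matrix Finset Polynomial
open Literature.MathematicalPhysics.QuantumLattice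
open scoped ComplexConjugate

/-! ## (A1) Trinomial pencils: `tr (M₀ + u M₊ + u⁻¹ M₋)^k` is a trigonometric polynomial of degree `≤ k` -/

section Pencil

variable {m : Type*} [Fintype m] [DecidableEq m]

omit [Fintype m] [DecidableEq m] in
/-- Every entry of the polynomial lift `Q(X) = M₋ + X M₀ + X² M₊` of the pencil (so that `u⁻¹ Q(u) = M₀ + u M₊ + u⁻¹ M₋`) has degree `≤ 2`. -/
theorem natDegree_pencilPoly_apply_le (M₀ Mp Mm : Matrix m m ℂ) (i j : m) :
    ((Mm.map Polynomial.C + (Polynomial.X : ℂ[X]) • M₀.map Polynomial.C + ((Polynomial.X : ℂ[X]) ^ 2) • Mp.map Polynomial.C) i j).natDegree ≤ 2 := by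
  simp only [Matrix.add_apply, Matrix.smul_apply, Matrix.map_apply, smul_eq_mul]
  refine (natDegree_add_le _ _).trans (max_le ((natDegree_add_le _ _).trans (max_le ?_ ?_)) ?_)
  · rw [natDegree_C]; omega
  · exact (natDegree_mul_C_le _ _).trans (natDegree_X_le.trans (by omega))
  · exact (natDegree_mul_C_le _ _).trans (natDegree_X_pow_le 2)

/-- Every entry of the `k`-th power of the lift has degree `≤ 2k`. -/
theorem natDegree_pencilPoly_pow_apply_le (M₀ Mp Mm : Matrix m m ℂ) (k : ℕ) (i j : m) :
    (((Mm.map Polynomial.C + (Polynomial.X : ℂ[X]) • M₀.map Polynomial.C + ((Polynomial.X : ℂ[X]) ^ 2) • Mp.map Polynomial.C) ^ k) i j).natDegree ≤ 2 * k := by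
  induction k generalizing i j with
  | zero =>
    rw [pow_zero, one_apply]
    split_ifs <;> simp
  | succ k ih =>
    rw [pow_succ, Matrix.mul_apply]
    refine natDegree_sum_le_of_forall_le _ _ fun l _ => ?_
    exact natDegree_mul_le.trans (by have := ih i l; have := natDegree_pencilPoly_apply_le M₀ Mp Mm l j; omega)

/-- The trace of the `k`-th power of the lift has degree `≤ 2k`. -/
theorem natDegree_trace_pencilPoly_pow_le (M₀ Mp Mm : Matrix m m ℂ) (k : ℕ) :
    (((Mm.map Polynomial.C + (Polynomial.X : ℂ[X]) • M₀.map Polynomial.C + ((Polynomial.X : ℂ[X]) ^ 2) • Mp.map Polynomial.C) ^ k).trace).natDegree ≤ 2 * k := by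
  unfold Matrix.trace
  exact natDegree_sum_le_of_forall_le _ _ fun i _ => natDegree_pencilPoly_pow_apply_le M₀ Mp Mm k i i

omit [Fintype m] [DecidableEq m] in
/-- Evaluating the lift at `u` gives `M₋ + u M₀ + u² M₊`. -/
theorem pencilPoly_map_eval (M₀ Mp Mm : Matrix m m ℂ) (u : ℂ) :
    (Mm.map Polynomial.C + (Polynomial.X : ℂ[X]) • M₀.map Polynomial.C + ((Polynomial.X : ℂ[X]) ^ 2) • Mp.map Polynomial.C).map (Polynomial.eval u) =
      Mm + u • M₀ + (u ^ 2) • Mp := by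
  ext i j
  simp only [Matrix.map_apply, Matrix.add_apply, Matrix.smul_apply, smul_eq_mul, Polynomial.eval_add,
    Polynomial.eval_mul, Polynomial.eval_C, Polynomial.eval_X, Polynomial.eval_pow]

/-- **(A1)** On the unit circle `u = e^{iψ}`: `tr (M₀ + u M₊ + u⁻¹ M₋)^k = Σ_{d ≤ 2k} g_d e^{i(d-k)ψ}` with the
coefficients `g_d` of `tr Q(X)^k` (independent of `ψ`). -/
theorem trace_pencil_pow_eq_sum (M₀ Mp Mm : Matrix m m ℂ) (k : ℕ) :
    ∃ g : ℕ → ℂ, ∀ ψ : ℝ,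
      ((M₀ + Complex.exp ((ψ : ℂ) * Complex.I) • Mp + Complex.exp (-((ψ : ℂ) * Complex.I)) • Mm) ^ k).trace =
        ∑ d ∈ Finset.range (2 * k + 1), g d * Complex.exp ((ψ : ℂ) * Complex.I * ((d : ℂ) - k)) := by
  refine ⟨fun d => (((Mm.map Polynomial.C + (Polynomial.X : ℂ[X]) • M₀.map Polynomial.C + ((Polynomial.X : ℂ[X]) ^ 2) • Mp.map Polynomial.C) ^ k).trace).coeff d,
    fun ψ => ?_⟩
  set u : ℂ := Complex.exp ((ψ : ℂ) * Complex.I) with hu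
  set v : ℂ := Complex.exp (-((ψ : ℂ) * Complex.I)) with hv
  have hvu : v * u = 1 := by rw [hu, hv, ← Complex.exp_add, neg_add_cancel, Complex.exp_zero]
  -- `M₀ + u Mp + v Mm = v • Q(u)`
  have hpencil : M₀ + u • Mp + v • Mm = v • (Mm + u • M₀ + (u ^ 2) • Mp) := by
    rw [smul_add, smul_add, smul_smul, smul_smul, hvu, one_smul, pow_two, ← mul_assoc, hvu, one_mul]
    abel
  have htrace : ((Mm + u • M₀ + (u ^ 2) • Mp) ^ k).trace =
      (((Mm.map Polynomial.C + (Polynomial.X : ℂ[X]) • M₀.map Polynomial.C + ((Polynomial.X : ℂ[X]) ^ 2) • Mp.map Polynomial.C) ^ k).trace).eval u := by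
    rw [← pencilPoly_map_eval, ← Polynomial.coe_evalRingHom, ← Matrix.map_pow, AddMonoidHom.map_trace]
  rw [hpencil, _root_.smul_pow, trace_smul, smul_eq_mul, htrace,
    eval_eq_sum_range' (n := 2 * k + 1) (lt_of_le_of_lt (natDegree_trace_pencilPoly_pow_le M₀ Mp Mm k) (by omega)),
    Finset.mul_sum]
  refine Finset.sum_congr rfl fun d _ => ?_
  have hexp : v ^ k * u ^ d = Complex.exp ((ψ : ℂ) * Complex.I * ((d : ℂ) - k)) := by
    rw [hu, hv, ← Complex.exp_nat_mul, ← Complex.exp_nat_mul, ← Complex.exp_add]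
    congr 1
    ring
  rw [← hexp]
  ring

end Pencil

/-! ## §A2 A trigonometric polynomial of degree `k < L` with period `2π/L` is constant -/

/-- Root-of-unity sums: `Σ_{l<L} e^{2πi l (d-k)/L} = 0` unless `L ∣ (d - k)`; here `|d - k| < L`, `d ≠ k`. -/
theorem sum_exp_two_pi_mul_div_eq_zero {k L D d : ℕ} (hkL : k < L) (hD : D ≤ k + L) (hd : d < D) (hdk : d ≠ k) :
    ∑ l ∈ Finset.range L, Complex.exp (((2 * Real.pi * l / L : ℝ) : ℂ) * Complex.I * ((d : ℂ) - k)) = 0 := by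
  have hL0 : (L : ℂ) ≠ 0 := by exact_mod_cast (show L ≠ 0 by omega)
  set ω : ℂ := Complex.exp (2 * Real.pi * Complex.I * ((d : ℂ) - k) / L) with hω
  have hterm : ∀ l : ℕ, Complex.exp (((2 * Real.pi * l / L : ℝ) : ℂ) * Complex.I * ((d : ℂ) - k)) = ω ^ l := by
    intro l
    rw [hω, ← Complex.exp_nat_mul]
    congr 1
    push_cast
    field_simp
  simp_rw [hterm]
  have hω1 : ω ≠ 1 := by
    intro h
    rw [hω, Complex.exp_eq_one_iff] at h
    obtain ⟨n, hn⟩ := h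
    have hπ : (2 * (Real.pi : ℂ) * Complex.I) ≠ 0 := by simp [Real.pi_ne_zero, Complex.I_ne_zero]
    have h2 : ((d : ℂ) - k) = n * L := by
      have e1 : ((d : ℂ) - k) = (2 * Real.pi * Complex.I * ((d : ℂ) - k) / L) * L / (2 * Real.pi * Complex.I) := by
        field_simp
      rw [e1, hn]
      field_simp
    have h3 : ((d : ℤ) - k : ℤ) = n * L := by exact_mod_cast h2
    have hd1 : (d : ℤ) < k + L := by exact_mod_cast (lt_of_lt_of_le hd hD)
    have hd0 : (0 : ℤ) ≤ d := by positivity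
    have hk1 : (k : ℤ) < L := by exact_mod_cast hkL
    have hdk' : (d : ℤ) ≠ k := by exact_mod_cast hdk
    rcases lt_trichotomy n 0 with hn0 | hn0 | hn0
    · nlinarith
    · rw [hn0, zero_mul] at h3
      exact hdk' (by omega)
    · nlinarith
  have hωL : ω ^ L = 1 := by
    rw [hω, ← Complex.exp_nat_mul]
    have : (L : ℂ) * (2 * Real.pi * Complex.I * ((d : ℂ) - k) / L) = (((d : ℤ) - k : ℤ) : ℂ) * (2 * Real.pi * Complex.I) := by
      push_cast
      field_simp
    rw [this, Complex.exp_int_mul_two_pi_mul_I]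
  rw [geom_sum_eq hω1, hωL, sub_self, zero_div]

/-- **(A2)** If `f(ψ) = Σ_{d<D} g_d e^{i(d-k)ψ}` with `D ≤ k + L`, `k < L`, and `f(ψ + 2π/L) = f(ψ)`, then `f` is constant:
averaging over the `L` shifts kills every frequency `d - k ≠ 0` (all have `|d - k| < L`). -/
theorem trigPoly_eq_const_of_periodic {k L D : ℕ} (hkL : k < L) (hD : D ≤ k + L) (g : ℕ → ℂ) (f : ℝ → ℂ)
    (hf : ∀ ψ : ℝ, f ψ = ∑ d ∈ Finset.range D, g d * Complex.exp ((ψ : ℂ) * Complex.I * ((d : ℂ) - k)))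
    (hper : ∀ ψ : ℝ, f (ψ + 2 * Real.pi / L) = f ψ) : ∀ ψ : ℝ, f ψ = f 0 := by
  have hL0 : (L : ℂ) ≠ 0 := by exact_mod_cast (show L ≠ 0 by omega)
  -- the constant
  set c : ℂ := ∑ d ∈ Finset.range D, if d = k then g d else 0 with hc
  -- iterated periodicity
  have hshift : ∀ (l : ℕ) (ψ : ℝ), f (ψ + 2 * Real.pi * l / L) = f ψ := by
    intro l
    induction l with
    | zero => intro ψ; simp
    | succ l ih =>
      intro ψ
      have : ψ + 2 * Real.pi * (l + 1 : ℕ) / L = (ψ + 2 * Real.pi * l / L) + 2 * Real.pi / L := by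
        push_cast; ring
      rw [this, hper, ih]
  have hmain : ∀ ψ : ℝ, (L : ℂ) * f ψ = (L : ℂ) * c := by
    intro ψ
    have hsum : ∑ l ∈ Finset.range L, f (ψ + 2 * Real.pi * l / L) = (L : ℂ) * f ψ := by
      rw [Finset.sum_congr rfl fun l _ => hshift l ψ, Finset.sum_const, Finset.card_range, nsmul_eq_mul]
    rw [← hsum]
    simp_rw [hf]
    rw [Finset.sum_comm]
    have hsplit : ∀ (d l : ℕ), g d * Complex.exp (((ψ + 2 * Real.pi * l / L : ℝ) : ℂ) * Complex.I * ((d : ℂ) - k)) =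
        g d * Complex.exp ((ψ : ℂ) * Complex.I * ((d : ℂ) - k)) *
          Complex.exp (((2 * Real.pi * l / L : ℝ) : ℂ) * Complex.I * ((d : ℂ) - k)) := by
      intro d l
      rw [show ((ψ + 2 * Real.pi * l / L : ℝ) : ℂ) * Complex.I * ((d : ℂ) - k) =
          (ψ : ℂ) * Complex.I * ((d : ℂ) - k) + ((2 * Real.pi * l / L : ℝ) : ℂ) * Complex.I * ((d : ℂ) - k) by
            push_cast; ring,
        Complex.exp_add]
      ring
    simp_rw [hsplit, ← Finset.mul_sum]
    rw [hc, Finset.mul_sum]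
    refine Finset.sum_congr rfl fun d hd => ?_
    rw [Finset.mem_range] at hd
    by_cases hdk : d = k
    · subst hdk
      rw [if_pos rfl]
      have h1 : ∀ l : ℕ, Complex.exp (((2 * Real.pi * l / L : ℝ) : ℂ) * Complex.I * ((d : ℂ) - d)) = 1 := fun l => by
        rw [sub_self, mul_zero, Complex.exp_zero]
      simp_rw [h1, sub_self, mul_zero, Complex.exp_zero, Finset.sum_const, Finset.card_range, nsmul_eq_mul]
      ring
    · rw [if_neg hdk, sum_exp_two_pi_mul_div_eq_zero hkL hD hd hdk]
      ring
  intro ψ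
  have h1 := hmain ψ
  have h2 := hmain 0
  have : f ψ = c := mul_left_cancel₀ hL0 h1
  rw [this, ← mul_left_cancel₀ hL0 h2]

/-! ## Unit-diagonal gauge invariance of traces of powers of sector blocks; blocks of pencils -/

section Blocks

variable {n : Type*} [Fintype n]

/-- `(P M Q)^k = P M^k Q` when `Q P = 1` and `P Q = 1`. -/
theorem mul_mul_pow_eq_of_mul_eq_one {q : Type*} [Fintype q] [DecidableEq q] [DecidableEq n] (P : Matrix q n ℂ) (Q : Matrix n q ℂ)
    (M : Matrix n n ℂ) (hQP : Q * P = 1) (hPQ : P * Q = 1) (k : ℕ) : (P * M * Q) ^ k = P * M ^ k * Q := by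
  induction k with
  | zero => rw [pow_zero, pow_zero, Matrix.mul_one, hPQ]
  | succ k ih =>
    rw [pow_succ, ih, pow_succ]
    simp only [Matrix.mul_assoc]
    rw [← Matrix.mul_assoc Q P, hQP, Matrix.one_mul]

/-- `tr (P M Q)^k = tr M^k` when `Q P = 1 = P Q`. -/
theorem trace_mul_mul_pow_eq_of_mul_eq_one {q : Type*} [Fintype q] [DecidableEq q] [DecidableEq n] (P : Matrix q n ℂ) (Q : Matrix n q ℂ)
    (M : Matrix n n ℂ) (hQP : Q * P = 1) (hPQ : P * Q = 1) (k : ℕ) : ((P * M * Q) ^ k).trace = (M ^ k).trace := by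
  rw [mul_mul_pow_eq_of_mul_eq_one P Q M hQP hPQ, Matrix.trace_mul_cycle, hQP, Matrix.one_mul]

/-- Unit-modulus diagonal conjugation does not change traces of powers of a sector block (for WHATEVER decidability
instance built the big diagonal). -/
theorem trace_pow_toBlock_diagonal_conj {inst : DecidableEq n} (v : n → ℂ) (hv : ∀ a, star (v a) * v a = 1)
    (M : Matrix n n ℂ) (p : n → Prop) [Fintype {a // p a}] [DecidableEq {a // p a}] (k : ℕ) :
    (((@diagonal n ℂ inst _ (fun a => star (v a)) * M * @diagonal n ℂ inst _ v).toBlock p p) ^ k).trace =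
      ((M.toBlock p p) ^ k).trace := by
  rw [toBlock_diagonal_mul_mul_diagonal]
  have h1 : (fun a : {a // p a} => v a * star (v a)) = fun _ => 1 := funext fun a => by rw [mul_comm]; exact hv a
  have h2 : (fun a : {a // p a} => star (v a) * v a) = fun _ => 1 := funext fun a => hv a
  refine trace_mul_mul_pow_eq_of_mul_eq_one _ _ _ ?_ ?_ k
  · rw [diagonal_mul_diagonal, h1, diagonal_one]
  · rw [diagonal_mul_diagonal, h2, diagonal_one]

end Blocks

/-- Sector blocks respect the pencil structure (`toBlock` is linear). -/
theorem toBlock_pencil {m : Type*} (A B C : Matrix m m ℂ) (a b : ℂ) (p : m → Prop) :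
    (A + a • B + b • C).toBlock p p = A.toBlock p p + a • B.toBlock p p + b • C.toBlock p p := by
  ext i j
  simp [toBlock_apply]

/-! ## (D) Taylor coefficients of `β ↦ tr e^{−βH}` at `β = 0` -/

section Flatness

open scoped Matrix.Norms.L2Operator

variable {m : Type*} [Fintype m] [DecidableEq m]

/-- `d/dβ tr (A^k e^{βA}) = tr (A^{k+1} e^{βA})` (Mathlib `hasDerivAt_exp_smul_const'` in the Banach algebra of matrices). -/
theorem hasDerivAt_trace_pow_mul_exp_smul (A : Matrix m m ℂ) (k : ℕ) (β : ℂ) :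
    HasDerivAt (fun b : ℂ => (A ^ k * NormedSpace.exp (b • A)).trace) ((A ^ (k + 1) * NormedSpace.exp (β • A)).trace) β := by
  have h1 : HasDerivAt (fun u : ℂ => NormedSpace.exp (u • A)) (A * NormedSpace.exp (β • A)) β :=
    hasDerivAt_exp_smul_const' A β
  set Lk : Matrix m m ℂ →L[ℂ] ℂ :=
    LinearMap.toContinuousLinearMap ((Matrix.traceLinearMap m ℂ ℂ) ∘ₗ (LinearMap.mulLeft ℂ (A ^ k))) with hLk
  have hL : ∀ X : Matrix m m ℂ, Lk X = (A ^ k * X).trace := fun X => rfl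
  have h2 := Lk.hasFDerivAt.comp_hasDerivAt β h1
  have heq : (⇑Lk ∘ fun u : ℂ => NormedSpace.exp (u • A)) = fun b : ℂ => (A ^ k * NormedSpace.exp (b • A)).trace :=
    funext fun u => by simp only [Function.comp_apply, hL]
  rw [heq, hL, ← Matrix.mul_assoc, ← pow_succ] at h2
  exact h2

/-- `(d/dβ)^k tr e^{βA} = tr (A^k e^{βA})`. -/
theorem iteratedDeriv_trace_exp_smul (A : Matrix m m ℂ) (k : ℕ) :
    iteratedDeriv k (fun b : ℂ => (NormedSpace.exp (b • A)).trace) = fun b : ℂ => (A ^ k * NormedSpace.exp (b • A)).trace := by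
  induction k with
  | zero => funext b; rw [iteratedDeriv_zero, pow_zero, Matrix.one_mul]
  | succ k ih =>
    rw [iteratedDeriv_succ, ih]
    funext β
    exact (hasDerivAt_trace_pow_mul_exp_smul A k β).deriv

/-- **Taylor coefficients of the partition function at infinite temperature**: `(d/dβ)^k tr e^{-βH} |_{β=0} = (-1)^k tr H^k`. -/
theorem iteratedDeriv_trace_exp_neg_smul (H : Matrix m m ℂ) (k : ℕ) :
    iteratedDeriv k (fun β : ℂ => (NormedSpace.exp (-β • H)).trace) 0 = (-1) ^ k * (H ^ k).trace := by
  have heq : (fun β : ℂ => (NormedSpace.exp (-β • H)).trace) = fun β : ℂ => (NormedSpace.exp (β • (-H))).trace := by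
    funext β
    rw [smul_neg, neg_smul]
  rw [heq, iteratedDeriv_trace_exp_smul]
  simp only
  rw [zero_smul, NormedSpace.exp_zero, Matrix.mul_one, show -H = (-1 : ℂ) • H by rw [neg_one_smul], _root_.smul_pow,
    trace_smul, smul_eq_mul]

end Flatness

end Summit.Ventures.CertifiedManyBodySolver.Theorems.TcThermcert1.FluxBlindness

end
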